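/-
Copyright (c) 2026. All rights reserved.
Released under Apache 2.0 license as described in the file LICENSE.
Authors: abc-iut cell, prover seat abc-iut-w6-d022 (gen 3, 2026-08-26; row «TLG-TEETH-DATUM»); doc-only v2 by the same
base (gen 4): locator fix (abc-iut-L4-t10 RQ7 LOW nit — the «{±1}- (resp. Ẑ^×-) multiple» sentence is Prop. 3.3 (i)'s
preamble, not Rmk. 3.2.2) + authors header — no declaration changed.
-/
import Literature.AnabelianGeometry.AbsoluteAnabelian.GaloisCyclotomeReciprocityFundamental
import Literature.AnabelianGeometry.EtaleTheta.CyclotomeAutZHat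
import Literature.AnabelianGeometry.EtaleTheta.CyclotomeZHatSign
import Literature.AnabelianGeometry.EtaleTheta.ZHatPadicCharacterSurjective
import HarnessLib

/-!
# `Ẑ^×` acts freely on torsion reciprocity data: twists OUTSIDE the `{±1}`-orbit (TLG teeth)

S. Mochizuki, *The Absolute Anabelian Geometry of Hyperbolic Curves* (2004) [AbsAnab], Prop. 1.2.1 (vi) p. 10
(«an isomorphism `μ_{ℚ/ℤ}(K̄₁) ⥲ μ_{ℚ/ℤ}(K̄₂)`»); *Topics in Absolute Anabelian Geometry III* [AbsTopIII], Rmk. 3.2.1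
p. 73 (THE natural `μ_Ẑ(M_TM) ⥲ μ_Ẑ(G)` is pinned «by imposing the condition of “compatibility with the natural
isomorphism of Corollary 1.10, (a)”»), Prop. 3.3 (i) p. 73, preamble l. 44–50 of that render (the natural
isomorphism `μ_Ẑ(M) ⥲ μ_Ẑ(G)` «is only determined up to a `{±1}`- (respectively, `Ẑ^×`-) multiple if `T = TLG`
(respectively, `T = TCG`)»; cf. Rmk. 3.2.2 p. 73 l. 31–33 for the `𝒪^×` Kummer maps: «only determined up to a
`Ẑ^×`-multiple»).

PROOF-ONLY file (theorems; no definitions, no named facts, no `sorry`), abc-iut cell layer L4, row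
«TLG-TEETH-DATUM» (the datum-level half of abc-iut-w6-d033's offer «TLG-TEETH»); sequel of
`GaloisCyclotomeReciprocityTwist.lean` (the inverse twist) and `GaloisCyclotomeReciprocityFundamental.lean`
(THE local-class-field-theory-normalised datum `TorsionReciprocityData.fundamental`).

THE POINT.  The tree packages the input `μ_{ℚ/ℤ}(G_k) ≅ μ(k̄)` as the STRUCTURE `TorsionReciprocityData k`
(axioms (T1)–(T4)).  The inverse twist shows these axioms pin the datum at most up to `±1`; but a TLG class of
[AbsTopIII] Prop. 3.3 (i)(c) ABSORBS exactly `±1` (abc-iut-w4-d009's `UnitKummerTheory.cycIsoClass_full`;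
abc-iut-w6-d033: «the INVERSE twist is INVISIBLE to the TLG class»), so `±1` alone does not show that a junction
built on a CHOSEN datum depends on the choice.  This file proves the honest teeth:
* **`Ẑ^× = Aut(Ẑ)` ACTS on torsion reciprocity data** (`exists_zhatTwist`): twisting every `θ_U` by `u`
  (a root of unity of order `n` goes to its `χ_n(u)`-th power, `χ_n = ZHatLevel.levelChar n`; natural in ALL
  homomorphisms of torsion abelian groups, so (T1)–(T4) survive) is again a datum `D_u`, acting on
  `μ_Ẑ(G_k) ≃* Λ(k̄ˣ)` through the tree's `Ẑ^×`-action `cyclotome.zhatTwist` (`muZhatEquiv_eq_trans_of_twist`);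
* **the action is FREE** on the `μ_Ẑ`-identifications (`eq_of_muZhatEquiv_eq_of_twist`, by `Aut(Λ(k̄ˣ)) = Ẑ^×`);
* **`Ẑ^× ⊋ {±1}`** (`ZHatLevel.exists_ne_one_ne_negOneAut`: the unit with `5`-adic character `2`), hence
  (`exists_muZhatEquiv_not_pm`) **every datum has a companion datum whose `μ_Ẑ`-identification is NEITHER the
  original NOR the original composed with inversion** — outside the `{±1}`-orbit a TLG class absorbs, the input
  of abc-iut-w4-d009's TLG criterion «classes equal ↔ `g′ = g ∨ g′ = inv ≫ g`»;
* for THE datum (`exists_not_isFundamental_not_pm`, `exists_family_muZhatEquiv_injective`): such companions are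
  not fundamental, and `u ↦ (fundamental k)_u` embeds `Ẑ^×` into the (T1)–(T4) data of `k`.
So «(c)-TLG for a CHOSEN datum» is print's statement only after the Rmk. 3.2.1 normalisation, and that residual
is REAL, not an artefact of `±1`.  Classical bookkeeping; nothing here bears on [IUTchIII] Cor. 3.12; no side taken.
-/

noncomputable section

open CategoryTheory ProfiniteGrp ProfiniteGrp.ProfiniteCompletion

/-! ### §0 A unit of `Ẑ` other than `±1` -/

namespace Literature.AnabelianGeometry.EtaleTheta.ZHatLevel

/-- `2 ≠ 1` in `ℤ/5ℤ`. [cite: RibesZalesskii2010, Thm 2.7.1] -/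
private theorem two_ne_one_zmod_five : (2 : ZMod 5) ≠ 1 := by decide

/-- `2 ≠ −1` in `ℤ/5ℤ`. [cite: RibesZalesskii2010, Thm 2.7.1] -/
private theorem two_ne_neg_one_zmod_five : (2 : ZMod 5) ≠ -1 := by decide

/-- **`Ẑ^× ≠ {±1}`**: there is an automorphism of `Ẑ` which is neither the identity nor inversion — the one
with `5`-adic cyclotomic character `2` (CRT section `Ẑ^× ↠ ℤ_5^×`, `padicChar_surjective_units`), detected by
its level-`5` character `2 ∉ {1, −1} ⊆ ℤ/5ℤ`. [cite: RibesZalesskii2010, Thm 2.7.1] -/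
theorem exists_ne_one_ne_negOneAut :
    ∃ u : MulAut (completion (GrpCat.of (Multiplicative ℤ))), u ≠ 1 ∧ u ≠ negOneAut := by
  haveI : Fact (Nat.Prime 5) := ⟨Nat.prime_five⟩
  have hcast : ((2 : ℤ) : ℤ_[5]) = 2 := by norm_cast
  have hnorm : ‖(2 : ℤ_[5])‖ = 1 := by
    refine le_antisymm (PadicInt.norm_le_one _) (not_lt.mp fun hlt => ?_)
    rw [← hcast] at hlt
    exact absurd ((PadicInt.norm_int_lt_one_iff_dvd (p := 5) 2).mp hlt) (by decide)
  have hunit : IsUnit (2 : ℤ_[5]) := PadicInt.isUnit_iff.mpr hnorm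
  obtain ⟨u, hu⟩ := padicChar_surjective_units 5 hunit.unit
  have h1 := toZModPow_padicChar 5 u 1
  rw [hu, IsUnit.unit_spec, map_ofNat] at h1
  refine ⟨u, fun h => ?_, fun h => ?_⟩
  · rw [h, map_one] at h1
    have h1' : (2 : ZMod 5) = 1 := h1
    exact two_ne_one_zmod_five h1'
  · rw [h, levelChar_negOneAut] at h1
    have h1' : (2 : ZMod 5) = -1 := h1
    exact two_ne_neg_one_zmod_five h1'

end Literature.AnabelianGeometry.EtaleTheta.ZHatLevel

/-! ### §1 The `Ẑ^×`-twist `a ↦ a ^ χ_{ord a}(u)` of a torsion element of a commutative group -/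

namespace Literature.AnabelianGeometry.EtaleTheta.cyclotome

open ZHatLevel

universe v

variable {A : Type v} [CommGroup A]

/-- A torsion element raised to `χ_n(u)` only depends on a level `n` killing it: `a ^ χ_n(u) = a ^ χ_N(u)` when
`a ^ n = a ^ N = 1` (compatibility `χ_{nN}(u) ≡ χ_n(u) (mod n)`). [cite: RibesZalesskii2010, Thm 2.7.1] -/
theorem pow_levelChar_eq_of_pow_eq_one {a : A} {n N : ℕ+} (hn : a ^ (n : ℕ) = 1) (hN : a ^ (N : ℕ) = 1)
    (u : MulAut (completion (GrpCat.of (Multiplicative ℤ)))) :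
    a ^ (levelChar n u).val = a ^ (levelChar N u).val := by
  haveI : NeZero (n : ℕ) := NeZero.of_pos n.pos
  haveI : NeZero (N : ℕ) := NeZero.of_pos N.pos
  have h1 : a ^ (levelChar (n * N) u).val = a ^ (levelChar n u).val :=
    pow_val_eq_pow_of_mod_eq hn (by rw [val_levelChar_mul_mod, Nat.mod_eq_of_lt (ZMod.val_lt _)])
  have h2 : a ^ (levelChar (N * n) u).val = a ^ (levelChar N u).val :=
    pow_val_eq_pow_of_mod_eq hN (by rw [val_levelChar_mul_mod, Nat.mod_eq_of_lt (ZMod.val_lt _)])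
  rw [mul_comm] at h2
  exact h1.symm.trans h2

/-- **The `Ẑ^×`-twist of a torsion element** `a ↦ a ^ χ_{ord a}(u)` is computed at ANY level `N` with
`a ^ N = 1`: `a ^ χ_{ord a}(u) = a ^ χ_N(u)`. [cite: RibesZalesskii2010, Thm 2.7.1] -/
theorem torsionTwist_eq_pow {a : A} {N : ℕ+} (hN : a ^ (N : ℕ) = 1)
    (u : MulAut (completion (GrpCat.of (Multiplicative ℤ)))) :
    a ^ (levelChar (orderOf a).toPNat' u).val = a ^ (levelChar N u).val := by
  have hfin : IsOfFinOrder a := isOfFinOrder_iff_pow_eq_one.mpr ⟨N, N.pos, hN⟩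
  refine pow_levelChar_eq_of_pow_eq_one ?_ hN u
  have ho : ((orderOf a).toPNat' : ℕ) = orderOf a := by
    rw [Nat.toPNat'_coe, if_pos hfin.orderOf_pos]
  rw [ho]
  exact pow_orderOf_eq_one a

/-- The twist is MULTIPLICATIVE on torsion elements. [cite: RibesZalesskii2010, Thm 2.7.1] -/
theorem torsionTwist_mul {a b : A} {n m : ℕ+} (ha : a ^ (n : ℕ) = 1) (hb : b ^ (m : ℕ) = 1)
    (u : MulAut (completion (GrpCat.of (Multiplicative ℤ)))) :
    (a * b) ^ (levelChar (orderOf (a * b)).toPNat' u).val =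
      a ^ (levelChar (orderOf a).toPNat' u).val * b ^ (levelChar (orderOf b).toPNat' u).val := by
  have ha' : a ^ ((n * m : ℕ+) : ℕ) = 1 := by rw [PNat.mul_coe, pow_mul, ha, one_pow]
  have hb' : b ^ ((n * m : ℕ+) : ℕ) = 1 := by rw [PNat.mul_coe, mul_comm, pow_mul, hb, one_pow]
  have hab : (a * b) ^ ((n * m : ℕ+) : ℕ) = 1 := by rw [mul_pow, ha', hb', one_mul]
  rw [torsionTwist_eq_pow hab, torsionTwist_eq_pow ha', torsionTwist_eq_pow hb', mul_pow]

/-- `a ^ χ_N(u) ^ χ_N(u⁻¹) = a`: the twists by `u` and `u⁻¹` are inverse to each other on `N`-torsion.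
[cite: RibesZalesskii2010, Thm 2.7.1] -/
theorem pow_levelChar_pow_levelChar_inv {a : A} {N : ℕ+} (hN : a ^ (N : ℕ) = 1)
    (u : MulAut (completion (GrpCat.of (Multiplicative ℤ)))) :
    (a ^ (levelChar N u).val) ^ (levelChar N u⁻¹).val = a := by
  rw [← pow_mul, pow_eq_pow_mod _ hN, ← ZMod.val_mul, levelChar_mul_levelChar_inv, ZMod.val_one_eq_one_mod,
    ← pow_eq_pow_mod _ hN, pow_one]

/-- The twist by `1 ∈ Aut(Ẑ)` is the identity on torsion. [cite: RibesZalesskii2010, Thm 2.7.1] -/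
theorem torsionTwist_one {a : A} {N : ℕ+} (hN : a ^ (N : ℕ) = 1) :
    a ^ (levelChar (orderOf a).toPNat' 1).val = a := by
  rw [torsionTwist_eq_pow hN, map_one, ZMod.val_one_eq_one_mod, ← pow_eq_pow_mod _ hN, pow_one]

end Literature.AnabelianGeometry.EtaleTheta.cyclotome

namespace Literature.AnabelianGeometry.AbsoluteAnabelian

open Literature.AnabelianGeometry.EtaleTheta Literature.AnabelianGeometry.EtaleTheta.ZHatLevel

namespace TorsionReciprocityData

/-! ### §2 `Aut(Ẑ)` acts on torsion reciprocity data -/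

section Twist

universe u

variable {k : Type u} [Field k] [CharZero k] (D : TorsionReciprocityData k)

/-- Every value `θ_U x` is a root of unity: `θ_U x ^ N = 1` for some `N ≥ 1` (`x` is torsion).
[cite: MochizukiAbsAnab2004, Prop 1.2.1 (vi) p.10] -/
theorem exists_θ_pow_eq_one (U : OpenSubgroup (Field.absoluteGaloisGroup k))
    (x : abelianizationTorsion (U : Subgroup (Field.absoluteGaloisGroup k))) :
    ∃ N : ℕ+, D.θ U x ^ (N : ℕ) = 1 := by
  obtain ⟨n, hn, hpow⟩ := (isOfFinOrder_iff_pow_eq_one).mp ((CommGroup.mem_torsion _).mp x.2)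
  have hx : x ^ n = 1 := Subtype.ext (by rw [Subgroup.coe_pow, hpow, Subgroup.coe_one])
  exact ⟨⟨n, hn⟩, by rw [PNat.mk_coe, ← map_pow, hx, map_one]⟩

/-- **`Ẑ^× = Aut(Ẑ)` ACTS on torsion reciprocity data.**  For every `u ∈ Aut(Ẑ)` and every datum `D`, twisting
every `θ_U : (U^ab)_tors → k̄ˣ` by `u` — a root of unity `ζ` of order `n` goes to `ζ ^ χ_n(u)` — again satisfies
(T1)–(T4): the twist is an automorphism of every torsion abelian group natural in all homomorphisms, so it
commutes with the Verlagerung (T2) and with the Galois action (T3), and is bijective on `μ(k̄)` ((T1), (T4)).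
So the axioms do not see the `Ẑ^×`-ambiguity of the identification `μ_{ℚ/ℤ}(G_k) ≅ μ(k̄)`.
[cite: MochizukiAbsTopIII2015, Remark 3.2.1 p.73] -/
theorem exists_zhatTwist (u : MulAut (completion (GrpCat.of (Multiplicative ℤ)))) :
    ∃ D' : TorsionReciprocityData k, ∀ (U : OpenSubgroup (Field.absoluteGaloisGroup k))
      (x : abelianizationTorsion (U : Subgroup (Field.absoluteGaloisGroup k))),
      D'.θ U x = D.θ U x ^ (levelChar (orderOf (D.θ U x)).toPNat' u).val := by
  let θ' : ∀ U : OpenSubgroup (Field.absoluteGaloisGroup k),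
      abelianizationTorsion (U : Subgroup (Field.absoluteGaloisGroup k)) →* (AlgebraicClosure k)ˣ := fun U =>
    { toFun := fun x => D.θ U x ^ (levelChar (orderOf (D.θ U x)).toPNat' u).val
      map_one' := by rw [map_one, one_pow]
      map_mul' := fun x y => by
        obtain ⟨N, hN⟩ := D.exists_θ_pow_eq_one U x
        obtain ⟨M, hM⟩ := D.exists_θ_pow_eq_one U y
        rw [map_mul]
        exact EtaleTheta.cyclotome.torsionTwist_mul hN hM u }
  have hθ' : ∀ (U : OpenSubgroup (Field.absoluteGaloisGroup k))
      (x : abelianizationTorsion (U : Subgroup (Field.absoluteGaloisGroup k))),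
      θ' U x = D.θ U x ^ (levelChar (orderOf (D.θ U x)).toPNat' u).val := fun U x => rfl
  refine ⟨{ θ := θ'
            θ_injective := fun U x y hxy => ?_
            θ_verlagerung := fun U V h x => ?_
            θ_conj := fun σ U x => ?_
            θ_exhaust := fun ζ hζ => ?_ }, hθ'⟩
  · -- (T1): untwist by `u⁻¹`
    obtain ⟨N, hN⟩ := D.exists_θ_pow_eq_one U x
    obtain ⟨M, hM⟩ := D.exists_θ_pow_eq_one U y
    have hN' : D.θ U x ^ ((N * M : ℕ+) : ℕ) = 1 := by rw [PNat.mul_coe, pow_mul, hN, one_pow]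
    have hM' : D.θ U y ^ ((N * M : ℕ+) : ℕ) = 1 := by rw [PNat.mul_coe, mul_comm, pow_mul, hM, one_pow]
    rw [hθ', hθ', EtaleTheta.cyclotome.torsionTwist_eq_pow hN',
      EtaleTheta.cyclotome.torsionTwist_eq_pow hM'] at hxy
    apply D.θ_injective U
    rw [← EtaleTheta.cyclotome.pow_levelChar_pow_levelChar_inv hN' u, hxy,
      EtaleTheta.cyclotome.pow_levelChar_pow_levelChar_inv hM' u]
  · -- (T2): the Verlagerung relation is between the SAME values
    rw [hθ', hθ', D.θ_verlagerung U V h x]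
  · -- (T3): Galois acts by field automorphisms, which commute with powers
    obtain ⟨N, hN⟩ := D.exists_θ_pow_eq_one U x
    have hN' : D.θ (imageOpenSubgroup (conjContinuousMulEquiv σ) U)
        (torsionTransport (conjContinuousMulEquiv σ) U x) ^ (N : ℕ) = 1 :=
      Units.ext (by rw [Units.val_pow_eq_pow_val, D.θ_conj σ U x, ← smul_pow', ← Units.val_pow_eq_pow_val,
        hN, Units.val_one, smul_one])
    rw [hθ', hθ', EtaleTheta.cyclotome.torsionTwist_eq_pow hN', EtaleTheta.cyclotome.torsionTwist_eq_pow hN,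
      Units.val_pow_eq_pow_val, Units.val_pow_eq_pow_val, D.θ_conj σ U x, smul_pow']
  · -- (T4): hit `ζ ^ χ(u⁻¹)`, whose twist by `u` is `ζ`
    obtain ⟨n, hn, hpow⟩ := (isOfFinOrder_iff_pow_eq_one).mp ((CommGroup.mem_torsion _).mp hζ)
    have hN : ζ ^ ((⟨n, hn⟩ : ℕ+) : ℕ) = 1 := hpow
    have hb : (ζ ^ (levelChar ⟨n, hn⟩ u⁻¹).val) ^ ((⟨n, hn⟩ : ℕ+) : ℕ) = 1 := by
      rw [← pow_mul, mul_comm, pow_mul, hN, one_pow]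
    obtain ⟨U, x, hx⟩ := D.θ_exhaust (ζ ^ (levelChar ⟨n, hn⟩ u⁻¹).val)
      ((CommGroup.mem_torsion _).mpr (isOfFinOrder_iff_pow_eq_one.mpr ⟨n, hn, hb⟩))
    refine ⟨U, x, ?_⟩
    rw [hθ', hx, EtaleTheta.cyclotome.torsionTwist_eq_pow hb]
    have h := EtaleTheta.cyclotome.pow_levelChar_pow_levelChar_inv hN u⁻¹
    rwa [inv_inv] at h

variable {D} {D' : TorsionReciprocityData k} {u : MulAut (completion (GrpCat.of (Multiplicative ℤ)))}

/-! From here on `h` says: `D'` is the twist of `D` by `u`. -/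

variable (h : ∀ (U : OpenSubgroup (Field.absoluteGaloisGroup k))
  (x : abelianizationTorsion (U : Subgroup (Field.absoluteGaloisGroup k))),
  D'.θ U x = D.θ U x ^ (levelChar (orderOf (D.θ U x)).toPNat' u).val)
include h

/-- The twist relation at any level `N` killing the value: `D'.θ_U x = (D.θ_U x) ^ χ_N(u)`.
[cite: MochizukiAbsTopIII2015, Remark 3.2.1 p.73] -/
theorem θ_eq_pow_levelChar_of_twist (U : OpenSubgroup (Field.absoluteGaloisGroup k))
    (x : abelianizationTorsion (U : Subgroup (Field.absoluteGaloisGroup k))) {N : ℕ+}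
    (hN : D.θ U x ^ (N : ℕ) = 1) : D'.θ U x = D.θ U x ^ (levelChar N u).val := by
  rw [h U x, EtaleTheta.cyclotome.torsionTwist_eq_pow hN]

/-- On the direct limit: `D'.muLift = (u · −) ∘ D.muLift` (values in `k̄ˣ`).
[cite: MochizukiAbsAnab2004, Prop 1.2.1 (vi) p.10] -/
theorem toMul_muLift_of_twist (z : muQZ (Field.absoluteGaloisGroup k)) :
    Additive.toMul (D'.muLift z) =
      Additive.toMul (D.muLift z) ^ (levelChar (orderOf (Additive.toMul (D.muLift z))).toPNat' u).val := by
  obtain ⟨U, x, rfl⟩ := muQZ.exists_of z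
  rw [muLift_of, muLift_of, toMul_ofMul, toMul_ofMul, h U x]

/-- … hence on the identification `equiv : μ_{ℚ/ℤ}(G_k) ≃+ (k̄ˣ)_tors` (values in `k̄ˣ`):
`D'.equiv z = (D.equiv z) ^ χ(u)`. [cite: MochizukiAbsAnab2004, Prop 1.2.1 (vi) p.10] -/
theorem coe_equiv_of_twist (z : muQZ (Field.absoluteGaloisGroup k)) :
    ((Additive.toMul (D'.equiv z) : CommGroup.torsion (AlgebraicClosure k)ˣ) : (AlgebraicClosure k)ˣ) =
      ((Additive.toMul (D.equiv z) : CommGroup.torsion (AlgebraicClosure k)ˣ) : (AlgebraicClosure k)ˣ) ^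
        (levelChar (orderOf ((Additive.toMul (D.equiv z) : CommGroup.torsion (AlgebraicClosure k)ˣ) :
          (AlgebraicClosure k)ˣ)).toPNat' u).val := by
  change ((Additive.toMul (D'.muTorsionHom z) : CommGroup.torsion (AlgebraicClosure k)ˣ) :
      (AlgebraicClosure k)ˣ) =
    ((Additive.toMul (D.muTorsionHom z) : CommGroup.torsion (AlgebraicClosure k)ˣ) : (AlgebraicClosure k)ˣ) ^
      (levelChar (orderOf ((Additive.toMul (D.muTorsionHom z) : CommGroup.torsion (AlgebraicClosure k)ˣ) :
        (AlgebraicClosure k)ˣ)).toPNat' u).val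
  rw [coe_muTorsionHom, coe_muTorsionHom, toMul_muLift_of_twist h z]

/-- **On `μ_Ẑ(G_k) ≃* Λ(k̄ˣ)` the twisted datum acts through the `Ẑ^×`-action on the cyclotome**:
`D'.muZhatEquiv ζ = u · (D.muZhatEquiv ζ)` (levelwise `ζ_n ↦ ζ_n ^ χ_n(u)`, the tree's `cyclotome.zhatTwist`).
[cite: MochizukiAbsTopIII2015, Remark 3.2.1 p.73] -/
theorem muZhatEquiv_apply_of_twist (ζ : muZhat (Field.absoluteGaloisGroup k)) :
    D'.muZhatEquiv ζ = EtaleTheta.cyclotome.zhatTwist (AlgebraicClosure k)ˣ u (D.muZhatEquiv ζ) := by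
  refine Subtype.ext (funext fun n => ?_)
  rw [EtaleTheta.cyclotome.zhatTwist_apply_coe,
    ← EtaleTheta.cyclotome.torsionTwist_eq_pow (EtaleTheta.cyclotome.pow_eq_one (D.muZhatEquiv ζ) n) u,
    muZhatEquiv_apply_coe, muZhatEquiv_apply_coe]
  exact coe_equiv_of_twist h _

/-- `D'.muZhatEquiv = D.muZhatEquiv ≫ (u · −)` as isomorphisms `μ_Ẑ(G_k) ≃* Λ(k̄ˣ)`.
[cite: MochizukiAbsTopIII2015, Remark 3.2.1 p.73] -/
theorem muZhatEquiv_eq_trans_of_twist :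
    D'.muZhatEquiv = D.muZhatEquiv.trans (EtaleTheta.cyclotome.zhatTwist (AlgebraicClosure k)ˣ u) :=
  MulEquiv.ext fun ζ => muZhatEquiv_apply_of_twist h ζ

/-! ### §3 The action is free on the `μ_Ẑ`-identifications; twists outside the `{±1}`-orbit -/

variable {D'' : TorsionReciprocityData k} {v : MulAut (completion (GrpCat.of (Multiplicative ℤ)))}

/-- **FREENESS**: the `μ_Ẑ`-identification of a twisted datum determines the twisting unit —
`D_u.muZhatEquiv = D_v.muZhatEquiv → u = v` (the `Ẑ^×`-action on `Λ(k̄ˣ)` is faithful, `cyclotome.zhatTwist_injective`,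
`k̄` having primitive roots of unity of every order). [cite: MochizukiAbsTopIII2015, Proposition 3.3 (ii) p.74] -/
theorem eq_of_muZhatEquiv_eq_of_twist
    (h'' : ∀ (U : OpenSubgroup (Field.absoluteGaloisGroup k))
      (x : abelianizationTorsion (U : Subgroup (Field.absoluteGaloisGroup k))),
      D''.θ U x = D.θ U x ^ (levelChar (orderOf (D.θ U x)).toPNat' v).val)
    (heq : D'.muZhatEquiv = D''.muZhatEquiv) : u = v := by
  apply EtaleTheta.cyclotome.zhatTwist_injective
    (EtaleTheta.cyclotome.exists_isPrimitiveRoot_of_isSepClosed (AlgebraicClosure k))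
  refine MulEquiv.ext fun ξ => ?_
  obtain ⟨ζ, rfl⟩ := D.muZhatEquiv.surjective ξ
  rw [← muZhatEquiv_apply_of_twist h, ← muZhatEquiv_apply_of_twist h'', heq]

/-- A twist by `u ≠ 1` CHANGES the `μ_Ẑ`-identification: `D_u.muZhatEquiv ≠ D.muZhatEquiv`.
[cite: MochizukiAbsTopIII2015, Remark 3.2.1 p.73] -/
theorem muZhatEquiv_ne_of_twist (hu : u ≠ 1) : D'.muZhatEquiv ≠ D.muZhatEquiv := by
  intro heq
  refine hu (eq_of_muZhatEquiv_eq_of_twist (D := D) (D' := D') (D'' := D) h (fun U x => ?_) heq)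
  obtain ⟨N, hN⟩ := D.exists_θ_pow_eq_one U x
  rw [EtaleTheta.cyclotome.torsionTwist_one hN]

/-- A twist by `u ≠ −1` is NOT the inverse of the original identification (target side):
`D_u.muZhatEquiv ≠ D.muZhatEquiv ≫ inv`. [cite: MochizukiAbsTopIII2015, Remark 3.2.1 p.73] -/
theorem muZhatEquiv_ne_trans_inv_of_twist (hu : u ≠ negOneAut) :
    D'.muZhatEquiv ≠ D.muZhatEquiv.trans (MulEquiv.inv (EtaleTheta.cyclotome (AlgebraicClosure k)ˣ)) := by
  intro heq
  apply hu
  apply EtaleTheta.cyclotome.zhatTwist_injective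
    (EtaleTheta.cyclotome.exists_isPrimitiveRoot_of_isSepClosed (AlgebraicClosure k))
  refine MulEquiv.ext fun ξ => ?_
  obtain ⟨ζ, rfl⟩ := D.muZhatEquiv.surjective ξ
  rw [← muZhatEquiv_apply_of_twist h, heq, EtaleTheta.cyclotome.zhatTwist_negOneAut]
  rfl

/-- The same on the source side: `D_u.muZhatEquiv ≠ inv ≫ D.muZhatEquiv` (the shape `g′ = (MulEquiv.inv _).trans g`
of abc-iut-w4-d009's TLG twist criterion). [cite: MochizukiAbsTopIII2015, Remark 3.2.1 p.73] -/
theorem muZhatEquiv_ne_inv_trans_of_twist (hu : u ≠ negOneAut) :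
    D'.muZhatEquiv ≠ (MulEquiv.inv (muZhat (Field.absoluteGaloisGroup k))).trans D.muZhatEquiv := by
  intro heq
  refine muZhatEquiv_ne_trans_inv_of_twist h hu (heq.trans (MulEquiv.ext fun ζ => ?_))
  change D.muZhatEquiv ζ⁻¹ = (D.muZhatEquiv ζ)⁻¹
  rw [map_inv]

omit h in
/-- **TLG TEETH (datum level).**  Every torsion reciprocity datum `D` of a field of characteristic `0` has a
companion datum `D'` — same axioms (T1)–(T4) — whose `μ_Ẑ`-identification `μ_Ẑ(G_k) ≃* Λ(k̄ˣ)` is NEITHER `D`'s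
NOR `D`'s composed with inversion (on either side): `D'` lies OUTSIDE the `{±1}`-orbit of `D`, the orbit a TLG
class of [AbsTopIII] Prop. 3.3 (i)(c) absorbs («only determined up to a `{±1}`-multiple»).  Hence the TLG
cyclotome class built on a CHOSEN datum depends on the choice; print removes the choice by the Rmk. 3.2.1
normalisation (`TorsionReciprocityData.fundamental`). [cite: MochizukiAbsTopIII2015, Prop 3.3 (i) p.73] -/
theorem exists_muZhatEquiv_not_pm (D : TorsionReciprocityData k) :
    ∃ D' : TorsionReciprocityData k,
      D'.muZhatEquiv ≠ D.muZhatEquiv ∧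
      D'.muZhatEquiv ≠ D.muZhatEquiv.trans (MulEquiv.inv (EtaleTheta.cyclotome (AlgebraicClosure k)ˣ)) ∧
      D'.muZhatEquiv ≠ (MulEquiv.inv (muZhat (Field.absoluteGaloisGroup k))).trans D.muZhatEquiv := by
  obtain ⟨u, hu1, hu2⟩ := ZHatLevel.exists_ne_one_ne_negOneAut
  obtain ⟨D', h⟩ := D.exists_zhatTwist u
  exact ⟨D', muZhatEquiv_ne_of_twist h hu1, muZhatEquiv_ne_trans_inv_of_twist h hu2,
    muZhatEquiv_ne_inv_trans_of_twist h hu2⟩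

end Twist

/-! ### §4 THE datum: the twists of `fundamental k` are pairwise different and not fundamental -/

section Fundamental

universe u

variable {k : Type u} [Field k] [CharZero k] [ValuativeRel k] [TopologicalSpace k] [IsNonarchimedeanLocalField k]
  {D D' : TorsionReciprocityData k} {u : MulAut (completion (GrpCat.of (Multiplicative ℤ)))}

/-- A non-trivial twist of a FUNDAMENTAL datum is not fundamental (uniqueness of the fundamental datum,
`IsFundamental.unique`). [cite: MochizukiAbsTopIII2015, Remark 3.2.1 p.73] -/
theorem IsFundamental.not_isFundamental_of_twist (hD : D.IsFundamental)
    (h : ∀ (U : OpenSubgroup (Field.absoluteGaloisGroup k))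
      (x : abelianizationTorsion (U : Subgroup (Field.absoluteGaloisGroup k))),
      D'.θ U x = D.θ U x ^ (levelChar (orderOf (D.θ U x)).toPNat' u).val)
    (hu : u ≠ 1) : ¬ D'.IsFundamental := fun hD' =>
  muZhatEquiv_ne_of_twist h hu (by rw [hD'.unique hD])

variable (k) in
/-- **The residual is REAL for THE datum**: there is a torsion reciprocity datum of `k` which is NOT fundamental
and whose `μ_Ẑ`-identification is outside the `{±1}`-orbit of THE (Rmk. 3.2.1-normalised) identification
`(fundamental k).muZhatEquiv` — so neither a `Classical.choice` of a datum nor the `{±1}`-class of such a choice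
is print's normalisation. [cite: MochizukiAbsTopIII2015, Remark 3.2.1 p.73] -/
theorem exists_not_isFundamental_not_pm :
    ∃ D' : TorsionReciprocityData k, ¬ D'.IsFundamental ∧
      D'.muZhatEquiv ≠ (fundamental k).muZhatEquiv ∧
      D'.muZhatEquiv ≠
        (fundamental k).muZhatEquiv.trans (MulEquiv.inv (EtaleTheta.cyclotome (AlgebraicClosure k)ˣ)) ∧
      D'.muZhatEquiv ≠ (MulEquiv.inv (muZhat (Field.absoluteGaloisGroup k))).trans (fundamental k).muZhatEquiv := by
  obtain ⟨u, hu1, hu2⟩ := ZHatLevel.exists_ne_one_ne_negOneAut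
  obtain ⟨D', h⟩ := (fundamental k).exists_zhatTwist u
  exact ⟨D', (fundamental_isFundamental k).not_isFundamental_of_twist h hu1, muZhatEquiv_ne_of_twist h hu1,
    muZhatEquiv_ne_trans_inv_of_twist h hu2, muZhatEquiv_ne_inv_trans_of_twist h hu2⟩

variable (k) in
/-- **`Ẑ^×` embeds into the (T1)–(T4) data of `k`**: there is a family of torsion reciprocity data indexed by
`Aut(Ẑ)`, through THE datum at `1`, with pairwise different `μ_Ẑ`-identifications (`u ↦ (fundamental k)_u`).
[cite: MochizukiAbsTopIII2015, Remark 3.2.1 p.73] -/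
theorem exists_family_muZhatEquiv_injective :
    ∃ F : MulAut (completion (GrpCat.of (Multiplicative ℤ))) → TorsionReciprocityData k,
      F 1 = fundamental k ∧ Function.Injective fun u => (F u).muZhatEquiv := by
  choose F hF using (fundamental k).exists_zhatTwist
  refine ⟨F, ext_θ (funext fun U => MonoidHom.ext fun x => ?_), fun u v huv => ?_⟩
  · obtain ⟨N, hN⟩ := (fundamental k).exists_θ_pow_eq_one U x
    rw [hF 1 U x, EtaleTheta.cyclotome.torsionTwist_one hN]
  · exact eq_of_muZhatEquiv_eq_of_twist (hF u) (hF v) huv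

end Fundamental

end TorsionReciprocityData

end Literature.AnabelianGeometry.AbsoluteAnabelian

end
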